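import Summits.ValiantsHypothesis.ValiantsHypothesis.Theses.KPlusLogSqLaw
import Summits.ValiantsHypothesis.ValiantsHypothesis.Theorems.KPlusLogSqLawTropicalBSplitDefs

/-!
# Route «KPlusLogSqLaw», crux `TropicalB` (stmt-ValiantsHypothesis-19771) — the BALANCED DOUBLING LAW implies `TropicalB`
# (a CONDITIONAL composition; the doubling law is NOT claimed)

HONEST FRAMING.  Helper file of the object-search cell `pub-symmetroid` (seat val-sym-trop-p2 g3) for the crux
`Summit.ValiantsHypothesis.ValiantsHypothesis.Theses.KPlusLogSqLaw.TropicalB` (ledger item `stmt-ValiantsHypothesis-19771`, route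
`KPlusLogSqLaw`; registered stubs `stub_tropThin` / `stub_tropFat` of `Cruxes/TropicalB/Lines/birth.lean`, each ⟺ the crux), landed
`--supports`; it does NOT close the item.  It proves an IMPLICATION between statements that are OPEN: nothing is asserted about
`TropicalB`, `WeakLifting`, `KPlusLogSqLaw`, `MatrixDescartes` (stmt-ValiantsHypothesis-18050) or `VP ≠ VNP`, and the hypothesis below
(«balanced doubling law») is NOT claimed — it is offered to the custody of the route (conjb-2) as a CANDIDATE CONTENT STATEMENT that is,
as far as anyone in the cell can prove, NOT equivalent to the crux (every registered reduction so far is an equivalence: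
`…TropicalBRegimeCollapse`, `…TropicalBStaticDiagonal`, `…TropicalBPermutationBudget`, `…TropicalBSignsFree`).

THE HYPOTHESIS (balanced doubling law with exponent `c`, stated inline, no definition): for all `K` and all balanced splits
`m = a + e` (`a ≤ e ≤ a + 1`) of the size, the UNSIGNED tropical rows (`TropRowD` of `…TropicalBSplitDefs`) satisfy
  `TropRowD a K B₁ → TropRowD e K B₂ → TropRowD (a + e) K ((a + e)^c · (B₁ + B₂ + 2))`,
i.e. doubling the size multiplies the census by at most a polynomial: `T(2a) + 1 ≲ (2a)^c·(2T(a) + 2)`.  WHY IT IS NATURAL (located,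
one seat): (i) it is K-FREE and SINGLE-SCALE; (ii) by this seat's `Halves.halves_subadditive` (`…TropicalBHalves`: at every cut,
chain length + #row images ≤ #distinct left halves + #distinct right halves, and each occurring half is a dominant term of a
half-size sub-design) it would follow from «the halves of a dominant chain at a balanced cut number at most `m^c` times the half-size
capacities»; (iii) the tree's unconditional instance is the halving inequality `tropRowD_halving` (val-sym-trop-p1) with `C(m, m/2)`
in place of `m^c` (all `m/2`-subsets as states; Hrubeš–Yehudayoff Prop. 23), and the Hessenberg sector has `m/2 + 1`
(`…TropicalBHessenberg`); (iv) every family in the tree or in print obeys it (staircase/Carstensen: ratio `2^{O(log m)}`; SHIFT-THREE: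
ratio `4`; counting-tight small formats); (v) `TropicalB` does NOT obviously imply it (the census could jump between consecutive
sizes inside the `2^{C(K+log² m)}` budget), so it is a genuinely stronger intermediate, not a rephrasing.

THE THEOREM.
* `Doubling.tropRowD_of_doubling` — under the doubling law with exponent `c`, every format `m ≤ 2^t` has the unsigned row bound
  `(K + 1)·2^{(c+2)(t+1)²}` (dyadic induction on a balanced split; base rows `tropRowD_size_zero`, `tropRowD_one` of
  `…TropicalBSplitDefs`; budget arithmetic `budget_step`);
* `Doubling.tropicalB_of_doubling` — **the balanced doubling law (any exponent `c`) implies `TropicalB`** with `C = 6(c + 2) + 1`, in fact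
  the K-FREE form `n ≤ (K+1)·2^{(c+2)(⌊log₂ m⌋+2)²}` at every format.

[folklore: Gusfield's dyadic recursion; the packaging is the cell's]
-/

-- `Summit.ValiantsHypothesis.ValiantsHypothesis.…` repeats a component by the D-0017 layout
-- (single-conjunct summit), which the `dupNamespace` linter flags; the name is mandated.
set_option linter.dupNamespace false
set_option autoImplicit false

namespace Summit.ValiantsHypothesis.ValiantsHypothesis.Theorems.KPlusLogSqLaw

open Summit.ValiantsHypothesis.ValiantsHypothesis.Theorems.MatrixDescartes.Negative
open Summit.ValiantsHypothesis.ValiantsHypothesis.Theorems.LacunarySymmetroidMatrixDescartes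
open Summit.ValiantsHypothesis.ValiantsHypothesis.Theorems.LacunarySymmetroidMatrixDescartes.TropicalCensus
open Summit.ValiantsHypothesis.ValiantsHypothesis.Theses.KPlusLogSqLaw

namespace Doubling

variable {c : ℕ}

/-- the budget step: `2^{c(t+1)}·(2·B_t + 2) ≤ B_{t+1}` for `B_t = (K+1)·2^{(c+2)(t+1)²}`. [arithmetic] -/
theorem budget_step (c K t : ℕ) :
    2 ^ (c * (t + 1)) * (2 * ((K + 1) * 2 ^ ((c + 2) * (t + 1) ^ 2)) + 2) ≤
      (K + 1) * 2 ^ ((c + 2) * (t + 1 + 1) ^ 2) := by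
  have hP : 1 ≤ 2 ^ ((c + 2) * (t + 1) ^ 2) := Nat.one_le_two_pow
  have h1 : 2 * ((K + 1) * 2 ^ ((c + 2) * (t + 1) ^ 2)) + 2 ≤ 2 ^ 2 * ((K + 1) * 2 ^ ((c + 2) * (t + 1) ^ 2)) := by
    nlinarith
  have hexp : c * (t + 1) + 2 + (c + 2) * (t + 1) ^ 2 ≤ (c + 2) * (t + 1 + 1) ^ 2 := by nlinarith
  calc 2 ^ (c * (t + 1)) * (2 * ((K + 1) * 2 ^ ((c + 2) * (t + 1) ^ 2)) + 2)
      ≤ 2 ^ (c * (t + 1)) * (2 ^ 2 * ((K + 1) * 2 ^ ((c + 2) * (t + 1) ^ 2))) := Nat.mul_le_mul_left _ h1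
    _ = (K + 1) * 2 ^ (c * (t + 1) + 2 + (c + 2) * (t + 1) ^ 2) := by rw [pow_add, pow_add]; ring
    _ ≤ (K + 1) * 2 ^ ((c + 2) * (t + 1 + 1) ^ 2) :=
        Nat.mul_le_mul_left _ (Nat.pow_le_pow_right (by norm_num) hexp)

/-- **dyadic induction**: under the balanced doubling law with exponent `c`, every format `m ≤ 2^t` has the unsigned row bound
`(K+1)·2^{(c+2)(t+1)²}`. -/
theorem tropRowD_of_doubling
    (hD : ∀ (K a e B₁ B₂ : ℕ), a ≤ e → e ≤ a + 1 → TropRowD a K B₁ → TropRowD e K B₂ →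
      TropRowD (a + e) K ((a + e) ^ c * (B₁ + B₂ + 2)))
    (K t m : ℕ) (hm : m ≤ 2 ^ t) : TropRowD m K ((K + 1) * 2 ^ ((c + 2) * (t + 1) ^ 2)) := by
  induction t generalizing m with
  | zero =>
    -- `m ≤ 1`
    have hB : K ≤ (K + 1) * 2 ^ ((c + 2) * (0 + 1) ^ 2) := by
      have : 1 ≤ 2 ^ ((c + 2) * (0 + 1) ^ 2) := Nat.one_le_two_pow
      nlinarith
    rcases Nat.le_one_iff_eq_zero_or_eq_one.mp (by simpa using hm) with rfl | rfl
    · exact tropRowD_size_zero K _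
    · exact tropRowD_mono ((Nat.sub_le K 1).trans hB) (tropRowD_one K)
  | succ t ih =>
    by_cases hsmall : m ≤ 2 ^ t
    · refine tropRowD_mono ?_ (ih m hsmall)
      exact Nat.mul_le_mul_left _ (Nat.pow_le_pow_right (by norm_num)
        (Nat.mul_le_mul_left _ (Nat.pow_le_pow_left (Nat.le_succ _) 2)))
    · -- balanced split `m = a + e`, `a = m / 2`
      push Not at hsmall
      set a := m / 2 with ha
      set e := m - m / 2 with he
      have hme : m = a + e := by omega
      have hae : a ≤ e := by omega
      have hea : e ≤ a + 1 := by omega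
      have hm2 : m ≤ 2 ^ t + 2 ^ t := by rw [pow_succ] at hm; omega
      have hat : a ≤ 2 ^ t := by omega
      have het : e ≤ 2 ^ t := by omega
      have h := hD K a e _ _ hae hea (ih a hat) (ih e het)
      rw [hme]
      refine tropRowD_mono ?_ h
      rw [← hme]
      have hmpow : m ^ c ≤ 2 ^ (c * (t + 1)) := by
        rw [mul_comm, pow_mul]
        exact Nat.pow_le_pow_left hm c
      calc m ^ c * ((K + 1) * 2 ^ ((c + 2) * (t + 1) ^ 2) + (K + 1) * 2 ^ ((c + 2) * (t + 1) ^ 2) + 2)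
          = m ^ c * (2 * ((K + 1) * 2 ^ ((c + 2) * (t + 1) ^ 2)) + 2) := by ring
        _ ≤ 2 ^ (c * (t + 1)) * (2 * ((K + 1) * 2 ^ ((c + 2) * (t + 1) ^ 2)) + 2) := Nat.mul_le_mul_right _ hmpow
        _ ≤ (K + 1) * 2 ^ ((c + 2) * (t + 1 + 1) ^ 2) := budget_step c K t

/-- **THE BALANCED DOUBLING LAW IMPLIES `TropicalB`** (indeed the K-free law `n ≤ (K+1)·2^{(c+2)(⌊log₂ m⌋+2)²}`).  The hypothesis is
NOT claimed; see the module docstring. -/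
theorem tropicalB_of_doubling
    (hD : ∀ (K a e B₁ B₂ : ℕ), a ≤ e → e ≤ a + 1 → TropRowD a K B₁ → TropRowD e K B₂ →
      TropRowD (a + e) K ((a + e) ^ c * (B₁ + B₂ + 2))) : TropicalB := by
  refine ⟨6 * (c + 2) + 1, fun m K => ?_⟩
  show TropRootLawAt m K (2 ^ ((6 * (c + 2) + 1) * (K + Nat.log 2 m ^ 2)))
  rcases Nat.eq_zero_or_pos K with rfl | hK
  · exact tropRootLawAt_of_tropRowD (tropRowD_zero m _)
  set L := Nat.log 2 m with hL
  have hm : m ≤ 2 ^ (L + 1) := (Nat.lt_pow_succ_log_self one_lt_two m).le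
  have h1 := tropRowD_of_doubling hD K (L + 1) m hm
  refine tropRootLawAt_of_tropRowD (tropRowD_mono ?_ h1)
  -- (K+1)·2^{(c+2)(L+2)²} ≤ 2^K · 2^{(c+2)(L+2)²} ≤ 2^{(6(c+2)+1)(K+L²)}
  have hK1 : K + 1 ≤ 2 ^ K := Nat.lt_two_pow_self
  have hexp : K + (c + 2) * (L + 1 + 1) ^ 2 ≤ (6 * (c + 2) + 1) * (K + L ^ 2) := by
    have h4 : (L + 1 + 1) ^ 2 ≤ 3 * L ^ 2 + 6 := by nlinarith [sq_nonneg ((L : ℤ) - 1)]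
    nlinarith
  calc (K + 1) * 2 ^ ((c + 2) * (L + 1 + 1) ^ 2) ≤ 2 ^ K * 2 ^ ((c + 2) * (L + 1 + 1) ^ 2) := Nat.mul_le_mul_right _ hK1
    _ = 2 ^ (K + (c + 2) * (L + 1 + 1) ^ 2) := (pow_add _ _ _).symm
    _ ≤ 2 ^ ((6 * (c + 2) + 1) * (K + L ^ 2)) := Nat.pow_le_pow_right (by norm_num) hexp

end Doubling

/-! ## 2. The law asked only FROM SIZE `K` ON (appended 2026-08-26, same seat)

The hypothesis of `tropicalB_of_doubling` above quantifies over ALL sizes; for sizes far below the number of classes the thin law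
`m!·(m(K−1)+1)` may be the truth, and then consecutive sizes differ by factors `≍ m` — so the all-sizes law could fail for a trivial
reason unrelated to the window.  The refined composition asks the doubling law only for balanced splits with `K ≤ a ≤ e ≤ a + 1` and
starts the dyadic induction from slope counting at the sizes `m ≤ 4K` (factor `2^{5K}`, harmless inside `2^{C(K + log² m)}`):
* `Doubling.tropRowD_small` — `T_D(m, K) ≤ 2^{5K}` for `m ≤ 4K` (`tropRowD_choose`);
* `Doubling.budget_step_mul` — the budget arithmetic with a general multiplier `M ≥ 1`;
* `Doubling.tropRowD_of_doubling_ge` — under the law from size `K` on, every format `m ≤ 2^t` has unsigned row bound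
  `2^{5K}·2^{(c+2)(t+1)²}`;
* `Doubling.tropicalB_of_doubling_ge` — **the balanced doubling law from size `K` on implies `TropicalB`**, `C = 6(c+2) + 5`.
What the refined law still asserts beyond `TropicalB` (located): in the fat corner `K ≤ a ≤ K²` it forbids exponential-in-`K` jumps
between consecutive sizes, where `TropicalB`'s budget `2^{CK}` is silent; nothing here claims it. -/

namespace Doubling

variable {c : ℕ}

/-- the budget step with a general multiplier: `2^{c(t+1)}·(2·B_t + 2) ≤ B_{t+1}` for `B_t = M·2^{(c+2)(t+1)²}`, `M ≥ 1`.
[arithmetic] -/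
theorem budget_step_mul (c M t : ℕ) (hM : 1 ≤ M) :
    2 ^ (c * (t + 1)) * (2 * (M * 2 ^ ((c + 2) * (t + 1) ^ 2)) + 2) ≤ M * 2 ^ ((c + 2) * (t + 1 + 1) ^ 2) := by
  have hP : 1 ≤ 2 ^ ((c + 2) * (t + 1) ^ 2) := Nat.one_le_two_pow
  have h1 : 2 * (M * 2 ^ ((c + 2) * (t + 1) ^ 2)) + 2 ≤ 2 ^ 2 * (M * 2 ^ ((c + 2) * (t + 1) ^ 2)) := by nlinarith
  have hexp : c * (t + 1) + 2 + (c + 2) * (t + 1) ^ 2 ≤ (c + 2) * (t + 1 + 1) ^ 2 := by nlinarith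
  calc 2 ^ (c * (t + 1)) * (2 * (M * 2 ^ ((c + 2) * (t + 1) ^ 2)) + 2)
      ≤ 2 ^ (c * (t + 1)) * (2 ^ 2 * (M * 2 ^ ((c + 2) * (t + 1) ^ 2))) := Nat.mul_le_mul_left _ h1
    _ = M * 2 ^ (c * (t + 1) + 2 + (c + 2) * (t + 1) ^ 2) := by rw [pow_add, pow_add]; ring
    _ ≤ M * 2 ^ ((c + 2) * (t + 1 + 1) ^ 2) := Nat.mul_le_mul_left _ (Nat.pow_le_pow_right (by norm_num) hexp)

/-- slope counting at the small sizes `m ≤ 4K`: `T_D(m, K) ≤ 2^{5K}`. [tree: `tropRowD_choose`] -/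
theorem tropRowD_small {m K : ℕ} (hm : m ≤ 4 * K) : TropRowD m K (2 ^ (5 * K)) := by
  refine tropRowD_mono ?_ (tropRowD_choose m K)
  calc (K + m - 1).choose m - 1 ≤ (K + m - 1).choose m := Nat.sub_le _ _
    _ ≤ 2 ^ (K + m - 1) := Nat.choose_le_two_pow _ _
    _ ≤ 2 ^ (5 * K) := Nat.pow_le_pow_right (by norm_num) (by omega)

/-- **dyadic induction, law from size `K` on**: every format `m ≤ 2^t` has unsigned row bound `2^{5K}·2^{(c+2)(t+1)²}`. -/
theorem tropRowD_of_doubling_ge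
    (hD : ∀ (K a e B₁ B₂ : ℕ), K ≤ a → a ≤ e → e ≤ a + 1 → TropRowD a K B₁ → TropRowD e K B₂ →
      TropRowD (a + e) K ((a + e) ^ c * (B₁ + B₂ + 2)))
    (K t m : ℕ) (hm : m ≤ 2 ^ t) : TropRowD m K (2 ^ (5 * K) * 2 ^ ((c + 2) * (t + 1) ^ 2)) := by
  have hM : 1 ≤ 2 ^ (5 * K) := Nat.one_le_two_pow
  induction t generalizing m with
  | zero =>
    rcases Nat.eq_zero_or_pos K with rfl | hK
    · exact tropRowD_zero m _
    · have hm4 : m ≤ 4 * K := by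
        have : m ≤ 1 := by simpa using hm
        omega
      refine tropRowD_mono ?_ (tropRowD_small hm4)
      have : 1 ≤ 2 ^ ((c + 2) * (0 + 1) ^ 2) := Nat.one_le_two_pow
      nlinarith
  | succ t ih =>
    by_cases hsmall : m ≤ 2 ^ t
    · refine tropRowD_mono ?_ (ih m hsmall)
      exact Nat.mul_le_mul_left _ (Nat.pow_le_pow_right (by norm_num)
        (Nat.mul_le_mul_left _ (Nat.pow_le_pow_left (Nat.le_succ _) 2)))
    · by_cases hm4 : m ≤ 4 * K
      · refine tropRowD_mono ?_ (tropRowD_small hm4)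
        have : 1 ≤ 2 ^ ((c + 2) * (t + 1 + 1) ^ 2) := Nat.one_le_two_pow
        nlinarith
      · -- balanced split `m = a + e`, `a = m / 2 ≥ K`
        push Not at hsmall hm4
        set a := m / 2 with ha
        set e := m - m / 2 with he
        have hme : m = a + e := by omega
        have hKa : K ≤ a := by omega
        have hae : a ≤ e := by omega
        have hea : e ≤ a + 1 := by omega
        have hm2 : m ≤ 2 ^ t + 2 ^ t := by rw [pow_succ] at hm; omega
        have hat : a ≤ 2 ^ t := by omega
        have het : e ≤ 2 ^ t := by omega
        have h := hD K a e _ _ hKa hae hea (ih a hat) (ih e het)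
        rw [hme]
        refine tropRowD_mono ?_ h
        rw [← hme]
        have hmpow : m ^ c ≤ 2 ^ (c * (t + 1)) := by
          rw [mul_comm, pow_mul]
          exact Nat.pow_le_pow_left hm c
        calc m ^ c * (2 ^ (5 * K) * 2 ^ ((c + 2) * (t + 1) ^ 2) + 2 ^ (5 * K) * 2 ^ ((c + 2) * (t + 1) ^ 2) + 2)
            = m ^ c * (2 * (2 ^ (5 * K) * 2 ^ ((c + 2) * (t + 1) ^ 2)) + 2) := by ring
          _ ≤ 2 ^ (c * (t + 1)) * (2 * (2 ^ (5 * K) * 2 ^ ((c + 2) * (t + 1) ^ 2)) + 2) := Nat.mul_le_mul_right _ hmpow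
          _ ≤ 2 ^ (5 * K) * 2 ^ ((c + 2) * (t + 1 + 1) ^ 2) := budget_step_mul c _ t hM

/-- **THE BALANCED DOUBLING LAW FROM SIZE `K` ON IMPLIES `TropicalB`**, with `C = 6(c + 2) + 5`.  The hypothesis is NOT claimed; see
the docstrings above. -/
theorem tropicalB_of_doubling_ge
    (hD : ∀ (K a e B₁ B₂ : ℕ), K ≤ a → a ≤ e → e ≤ a + 1 → TropRowD a K B₁ → TropRowD e K B₂ →
      TropRowD (a + e) K ((a + e) ^ c * (B₁ + B₂ + 2))) : TropicalB := by
  refine ⟨6 * (c + 2) + 5, fun m K => ?_⟩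
  show TropRootLawAt m K (2 ^ ((6 * (c + 2) + 5) * (K + Nat.log 2 m ^ 2)))
  rcases Nat.eq_zero_or_pos K with rfl | hK
  · exact tropRootLawAt_of_tropRowD (tropRowD_zero m _)
  set L := Nat.log 2 m with hL
  have hm : m ≤ 2 ^ (L + 1) := (Nat.lt_pow_succ_log_self one_lt_two m).le
  have h1 := tropRowD_of_doubling_ge hD K (L + 1) m hm
  refine tropRootLawAt_of_tropRowD (tropRowD_mono ?_ h1)
  have hexp : 5 * K + (c + 2) * (L + 1 + 1) ^ 2 ≤ (6 * (c + 2) + 5) * (K + L ^ 2) := by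
    have h4 : (L + 1 + 1) ^ 2 ≤ 3 * L ^ 2 + 6 := by nlinarith [sq_nonneg ((L : ℤ) - 1)]
    nlinarith
  calc 2 ^ (5 * K) * 2 ^ ((c + 2) * (L + 1 + 1) ^ 2) = 2 ^ (5 * K + (c + 2) * (L + 1 + 1) ^ 2) := (pow_add _ _ _).symm
    _ ≤ 2 ^ ((6 * (c + 2) + 5) * (K + L ^ 2)) := Nat.pow_le_pow_right (by norm_num) hexp

end Doubling

end Summit.ValiantsHypothesis.ValiantsHypothesis.Theorems.KPlusLogSqLaw
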